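import Summits.QuantumAdvantage.QuantumAdvantage.Theorems.CubicForrelationNearExactIsExactCubicFormR2Frame
import Summits.QuantumAdvantage.QuantumAdvantage.Theorems.CubicForrelationNearExactIsExactCubicFormTensor
import Summits.QuantumAdvantage.QuantumAdvantage.Theorems.CubicForrelationNearExactIsExactTwelvePartnerSymplectic

/-!
# Crux `CubicForrelation.NearExactIsExact` (stmt-QuantumAdvantage-14043) — E1280-even, R2 branch, step 1: the partner data IN THE ADAPTED FRAME

Certificate seat `b2b-cforr-cert` (gen 42).  HONEST FRAMING: kernel-checked bookkeeping (standard axioms) — the first step of the branch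
statement `HR2` of `tpw_weight_ge_1280_of_branches` (…TwelvePartnerLight): it moves a cubic `κ` on `3 + m` bits with an R2 direction
(`#{κ ≠ κ(·⊕a)} = 2^{m+1}`), its cubic form `d` and a pairing partner `c` into the ADAPTED FRAME of R2-PARTNER.md §2, keeping every hypothesis
in the shape the cell lemmas (…CubicFormCells, `hD` with `c₁ = c₂ = 0`) and the leaves (`tpa_R2_*`, `hF1`) consume.  Nothing about `θ₁₂`;
NOT summit progress.

`tpw_R2_partner_frame`: from `κ` (cubic), `c` (symmetric, zero diagonals), `d` (the cubic form of `κ` at unit vectors, symmetric with zero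
diagonals), `(PAIR)` and `a ≠ 0` with `2^{m+1}` changes, there are `κ', c', d'` on the same `3 + m` bits with: `κ'` cubic of the same weight;
`c'` symmetric with zero diagonals; `d'` the cubic form of `κ'`; `(PAIR)` for `(c', d')`; the frame identity `κ'(y) ⊕ κ'(y ⊕ e₀) = y₁ y₂`;
and `hF1`: `d'(e₀, j, k) = [{j,k} = {1,2}]`.
Ingredients: `tcr2_adapted` (the frame `P`, translated by `(0, c₁, c₂, 0)` to remove the offsets), `tct_comp_isDegLeFun`, `tct_card_comp_eq`,
`tct_third_comp_coord` (3-form law), `tcx_transport_hyps` (symmetries of the transported 3-vector), `tps_pair_covariant` (covariance of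
`(PAIR)`), `tct_third_of_product_slice` (`hF1`).

References: this seat lineage (g37 R2-PARTNER §1–2, g39 HANDPROOFS §3 (L4), g40 frame layer).  Axioms: the standard three.
-/

set_option linter.dupNamespace false -- D-0017: single-problem summit ⇒ `QuantumAdvantage.QuantumAdvantage` by design

namespace Summit.QuantumAdvantage.QuantumAdvantage.Theorems.CubicForrelation.NearExactIsExact

open Finset
open Literature.Computability.QuantumComplexity
open Literature.Computability.QuantumComplexity.BuzetChailloux (bxor zeroVec bxor_comm bxor_self bxor_zeroVec zeroVec_bxor
  bxor_bxor_cancel_left)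

variable {m : ℕ}

/-- A Boolean bookkeeping identity: for bits with `A ∧ C` impossible, `[(A∧B) ⊕ (C∧D)] = [(A∧B) ∨ (C∧D)]` in `𝔽₂`. [folklore] -/
theorem tpw_key_F1 : ∀ A B C D : Bool, (A && C) = false →
    ((if ((A && B) ^^ (C && D)) = true then (1 : ZMod 2) else 0) =
      if (A = true ∧ B = true) ∨ (C = true ∧ D = true) then 1 else 0) := by
  decide

/-- **R2, step 1: the partner data in the adapted frame.**  Let `κ` be cubic on `3 + m` bits, `d` its cubic form at unit vectors
(`hd`; symmetric with zero diagonals: `hds`, `hdd`), `c` a symmetric pairing partner (`hcs`, `hcc`, `hcd`, `hpair`), and `a ≠ 0` a direction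
with exactly `2^{m+1}` points `x` where `κ x ≠ κ(x ⊕ a)`.  Then, after an affine change of frame (`tcr2_adapted` followed by the translation
removing the offsets `c₁, c₂`), we obtain `κ', c', d'` with: `κ'` cubic, `wt κ' = wt κ`, `c'` symmetric with zero diagonals, `d'` the cubic form
of `κ'` at unit vectors, `(PAIR)` for `(c', d')` (`tps_pair_covariant`), the FRAME IDENTITY `κ'(y) ⊕ κ'(y ⊕ e₀) = y₁ ∧ y₂` (hypothesis `hD` of
…CubicFormCells with `c₁ = c₂ = 0`), and `hF1`: `d'(e₀,j,k) = [{j,k} = {e₁,e₂}]` (`tct_third_of_product_slice`). [this work] -/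
theorem tpw_R2_partner_frame (κ : (Fin (3 + m) → Bool) → Bool) (hκ : IsDegLeFun 3 κ)
    (c d : Fin (3 + m) → Fin (3 + m) → Fin (3 + m) → ZMod 2)
    (hcs : ∀ p j k, c p k j = c p j k) (hcc : ∀ p j k, c j p k = c p j k) (hcd : ∀ p j, c p j j = 0)
    (hds : ∀ φ j k, d φ k j = d φ j k) (hdd : ∀ φ j, d φ j j = 0)
    (hd : ∀ φ j k, d φ j k =
      if ((((κ zeroVec ^^ κ (bxor zeroVec (fun l => decide (l = k)))) ^^
            (κ (bxor zeroVec (fun l => decide (l = j))) ^^ κ (bxor (bxor zeroVec (fun l => decide (l = j))) (fun l => decide (l = k))))) ^^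
          ((κ (bxor zeroVec (fun l => decide (l = φ))) ^^ κ (bxor (bxor zeroVec (fun l => decide (l = φ))) (fun l => decide (l = k)))) ^^
            (κ (bxor (bxor zeroVec (fun l => decide (l = φ))) (fun l => decide (l = j))) ^^
              κ (bxor (bxor (bxor zeroVec (fun l => decide (l = φ))) (fun l => decide (l = j))) (fun l => decide (l = k))))))) = true
      then 1 else 0)
    (hpair : ∀ p φ, (∑ j, ∑ k, (if j < k then c p j k * d φ j k else 0)) = if p = φ then 1 else 0)
    (a : Fin (3 + m) → Bool) (ha : a ≠ zeroVec)
    (hDa : #(univ.filter fun x : Fin (3 + m) → Bool => (κ x ^^ κ (bxor x a)) = true) = 2 ^ (m + 1)) :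
    ∃ (κ' : (Fin (3 + m) → Bool) → Bool) (c' d' : Fin (3 + m) → Fin (3 + m) → Fin (3 + m) → ZMod 2),
      IsDegLeFun 3 κ' ∧
      #(univ.filter fun y : Fin (3 + m) → Bool => κ' y = true) = #(univ.filter fun x : Fin (3 + m) → Bool => κ x = true) ∧
      (∀ p j k, c' p k j = c' p j k) ∧ (∀ p j k, c' j p k = c' p j k) ∧ (∀ p j, c' p j j = 0) ∧
      (∀ φ j k, d' φ j k =
        if ((((κ' zeroVec ^^ κ' (bxor zeroVec (fun l => decide (l = k)))) ^^
                (κ' (bxor zeroVec (fun l => decide (l = j))) ^^ κ' (bxor (bxor zeroVec (fun l => decide (l = j))) (fun l => decide (l = k))))) ^^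
              ((κ' (bxor zeroVec (fun l => decide (l = φ))) ^^ κ' (bxor (bxor zeroVec (fun l => decide (l = φ))) (fun l => decide (l = k)))) ^^
                (κ' (bxor (bxor zeroVec (fun l => decide (l = φ))) (fun l => decide (l = j))) ^^
                  κ' (bxor (bxor (bxor zeroVec (fun l => decide (l = φ))) (fun l => decide (l = j))) (fun l => decide (l = k))))))) = true
        then 1 else 0) ∧
      (∀ p φ, (∑ j, ∑ k, (if j < k then c' p j k * d' φ j k else 0)) = if p = φ then 1 else 0) ∧
      (∀ y, (κ' y ^^ κ' (bxor y (fun l => decide (l = Fin.castAdd m (0 : Fin 3))))) =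
        (y (Fin.castAdd m (1 : Fin 3)) && y (Fin.castAdd m (2 : Fin 3)))) ∧
      (∀ j k, d' (Fin.castAdd m (0 : Fin 3)) j k =
        if (j = Fin.castAdd m (1 : Fin 3) ∧ k = Fin.castAdd m (2 : Fin 3)) ∨ (j = Fin.castAdd m (2 : Fin 3) ∧ k = Fin.castAdd m (1 : Fin 3))
        then 1 else 0) := by
  obtain ⟨P, Pi, c₁, c₂, hPPi, hPiP, -, -, -, hD₁⟩ := tcr2_adapted κ hκ a ha hDa
  dsimp only at hD₁
  -- the translation `t = (0, c₁, c₂, 0, …)` removing the offsets, and `b := P t`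
  have hne12 : (Fin.castAdd m (1 : Fin 3)) ≠ Fin.castAdd m (2 : Fin 3) := by
    intro h
    have := congrArg Fin.val h
    simp [Fin.val_castAdd] at this
  obtain ⟨t, ht1, ht2⟩ : ∃ t : Fin (3 + m) → Bool, t (Fin.castAdd m (1 : Fin 3)) = c₁ ∧ t (Fin.castAdd m (2 : Fin 3)) = c₂ :=
    ⟨fun l => (decide (l = Fin.castAdd m (1 : Fin 3)) && c₁) || (decide (l = Fin.castAdd m (2 : Fin 3)) && c₂),
      by simp [hne12], by simp [hne12.symm]⟩
  obtain ⟨b, hb⟩ : ∃ b : Fin (3 + m) → Bool,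
      b = fun ψ => decide ((∑ φ, P ψ φ * (if t φ = true then (1 : ZMod 2) else 0)) = 1) := ⟨_, rfl⟩
  obtain ⟨κ', hfun⟩ : ∃ κ' : (Fin (3 + m) → Bool) → Bool,
      κ' = fun y => κ (bxor b (fun ψ => decide ((∑ φ, P ψ φ * (if y φ = true then (1 : ZMod 2) else 0)) = 1))) := ⟨_, rfl⟩
  have hκ'ap : ∀ y, κ' y = κ (bxor b (fun ψ => decide ((∑ φ, P ψ φ * (if y φ = true then (1 : ZMod 2) else 0)) = 1))) :=
    fun y => by rw [hfun]
  -- `κ'` is the frame function of `tcr2_adapted`, pre-composed with the translation by `t`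
  have hκ₁eq : ∀ y, κ' y =
      κ (bxor zeroVec (fun ψ => decide ((∑ φ, P ψ φ * (if (bxor y t) φ = true then (1 : ZMod 2) else 0)) = 1))) := by
    intro y
    rw [hκ'ap y, hb, tct_lin_bxor P y t, zeroVec_bxor, bxor_comm]
  -- the transported tensors
  obtain ⟨d', hd'⟩ : ∃ d' : Fin (3 + m) → Fin (3 + m) → Fin (3 + m) → ZMod 2,
      ∀ φ j k, d' φ j k = ∑ ψ, ∑ α, ∑ β, P ψ φ * P α j * P β k * d ψ α β := ⟨_, fun _ _ _ => rfl⟩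
  obtain ⟨c', hc'⟩ : ∃ c' : Fin (3 + m) → Fin (3 + m) → Fin (3 + m) → ZMod 2,
      ∀ p j k, c' p j k = ∑ q, ∑ α, ∑ β, Pi p q * Pi j α * Pi k β * c q α β := ⟨_, fun _ _ _ => rfl⟩
  -- the frame identity with zero offsets
  have hD' : ∀ y, (κ' y ^^ κ' (bxor y (fun l => decide (l = Fin.castAdd m (0 : Fin 3))))) =
      (y (Fin.castAdd m (1 : Fin 3)) && y (Fin.castAdd m (2 : Fin 3))) := by
    intro y
    have hassoc : bxor (bxor y (fun l => decide (l = Fin.castAdd m (0 : Fin 3)))) t =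
        bxor (bxor y t) (fun l => decide (l = Fin.castAdd m (0 : Fin 3))) := by
      rw [iw_bxor_assoc, bxor_comm (fun l => decide (l = Fin.castAdd m (0 : Fin 3))) t, ← iw_bxor_assoc]
    rw [hκ₁eq y, hκ₁eq (bxor y _), hassoc, hD₁ (bxor y t)]
    show (((y _ ^^ t _) ^^ c₁) && ((y _ ^^ t _) ^^ c₂)) = _
    rw [ht1, ht2]
    cases y (Fin.castAdd m (1 : Fin 3)) <;> cases y (Fin.castAdd m (2 : Fin 3)) <;> cases c₁ <;> cases c₂ <;> rfl
  -- `d'` is the cubic form of `κ'` (the 3-form law)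
  have hd'T : ∀ φ j k, d' φ j k =
      if ((((κ' zeroVec ^^ κ' (bxor zeroVec (fun l => decide (l = k)))) ^^
                (κ' (bxor zeroVec (fun l => decide (l = j))) ^^ κ' (bxor (bxor zeroVec (fun l => decide (l = j))) (fun l => decide (l = k))))) ^^
              ((κ' (bxor zeroVec (fun l => decide (l = φ))) ^^ κ' (bxor (bxor zeroVec (fun l => decide (l = φ))) (fun l => decide (l = k)))) ^^
                (κ' (bxor (bxor zeroVec (fun l => decide (l = φ))) (fun l => decide (l = j))) ^^
                  κ' (bxor (bxor (bxor zeroVec (fun l => decide (l = φ))) (fun l => decide (l = j))) (fun l => decide (l = k))))))) = true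
      then 1 else 0 := by
    intro φ j k
    have h := tct_third_comp_coord κ P b hκ φ j k zeroVec zeroVec
    dsimp only at h
    rw [hfun]
    dsimp only
    rw [h, hd']
    exact Finset.sum_congr rfl fun ψ _ => Finset.sum_congr rfl fun α _ => Finset.sum_congr rfl fun β _ => by rw [hd ψ α β]
  refine ⟨κ', c', d', ?_, ?_, ?_, ?_, ?_, hd'T, ?_, hD', ?_⟩
  · rw [hfun]; exact tct_comp_isDegLeFun κ hκ P b
  · rw [hfun]; exact tct_card_comp_eq P Pi κ hPPi hPiP b
  · intro p j k; rw [hc', hc']; exact (tcx_transport_hyps c Pi hcs hcc hcd).1 p j k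
  · intro p j k; rw [hc', hc']; exact (tcx_transport_hyps c Pi hcs hcc hcd).2.1 p j k
  · intro p j; rw [hc']; exact (tcx_transport_hyps c Pi hcs hcc hcd).2.2 p j
  · -- covariance of (PAIR)
    intro p φ
    have h := tps_pair_covariant c d hcs hcd hds hdd hpair (Matrix.of fun ψ φ => P ψ φ) (Matrix.of fun ψ φ => Pi ψ φ)
      (tcr2_matrix_inv P Pi hPiP) p φ
    simp only [Matrix.of_apply] at h
    rw [← h]
    exact Finset.sum_congr rfl fun j _ => Finset.sum_congr rfl fun k _ => by rw [hc', hd']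
  · -- hF1 from the frame identity
    have hq : ∀ y, (κ' y ^^ κ' (bxor y (fun l => decide (l = Fin.castAdd m (0 : Fin 3))))) =
        ((y (Fin.castAdd m (1 : Fin 3)) ^^ false) && (y (Fin.castAdd m (2 : Fin 3)) ^^ false)) := fun y => by
      rw [hD' y, Bool.xor_false, Bool.xor_false]
    intro j k
    have h1 : d' (Fin.castAdd m (0 : Fin 3)) j k = d' j k (Fin.castAdd m (0 : Fin 3)) := by
      rw [hd'T (Fin.castAdd m (0 : Fin 3)) j k, hd'T j k (Fin.castAdd m (0 : Fin 3)),
        tcf_third_swap12 κ' (fun l => decide (l = Fin.castAdd m (0 : Fin 3))) (fun l => decide (l = j)) (fun l => decide (l = k)) zeroVec,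
        tcf_third_swap23 κ' (fun l => decide (l = j)) (fun l => decide (l = Fin.castAdd m (0 : Fin 3))) (fun l => decide (l = k)) zeroVec]
    rw [h1, hd'T j k (Fin.castAdd m (0 : Fin 3)),
      tct_third_of_product_slice κ' (fun l => decide (l = Fin.castAdd m (0 : Fin 3))) (Fin.castAdd m (1 : Fin 3)) (Fin.castAdd m (2 : Fin 3))
        false false hq (fun l => decide (l = j)) (fun l => decide (l = k)) zeroVec]
    have hAC : (decide (Fin.castAdd m (1 : Fin 3) = j) && decide (Fin.castAdd m (2 : Fin 3) = j)) = false := by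
      by_cases hj : Fin.castAdd m (1 : Fin 3) = j
      · have hj' : ¬ Fin.castAdd m (2 : Fin 3) = j := fun h' => hne12 (hj.trans h'.symm)
        simp [hj']
      · simp [hj]
    rw [tpw_key_F1 _ _ _ _ hAC]
    simp only [decide_eq_true_eq]
    have hiff : ((Fin.castAdd m (1 : Fin 3) = j ∧ Fin.castAdd m (2 : Fin 3) = k) ∨ (Fin.castAdd m (2 : Fin 3) = j ∧ Fin.castAdd m (1 : Fin 3) = k)) ↔
        ((j = Fin.castAdd m (1 : Fin 3) ∧ k = Fin.castAdd m (2 : Fin 3)) ∨ (j = Fin.castAdd m (2 : Fin 3) ∧ k = Fin.castAdd m (1 : Fin 3))) := by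
      constructor
      · rintro (⟨h1, h2⟩ | ⟨h1, h2⟩)
        · exact Or.inl ⟨h1.symm, h2.symm⟩
        · exact Or.inr ⟨h1.symm, h2.symm⟩
      · rintro (⟨h1, h2⟩ | ⟨h1, h2⟩)
        · exact Or.inl ⟨h1.symm, h2.symm⟩
        · exact Or.inr ⟨h1.symm, h2.symm⟩
    simp only [hiff]

end Summit.QuantumAdvantage.QuantumAdvantage.Theorems.CubicForrelation.NearExactIsExact
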